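import Literature.Probability.RandomPlanarGeometry.RestrictionContinuity
import Literature.Probability.RandomPlanarGeometry.PlusHullKoebe
import Literature.Probability.RandomPlanarGeometry.RestrictionMeasuresProofs
import Literature.Probability.RandomPlanarGeometry.HalfPlaneFillProofs
import Literature.Probability.RandomPlanarGeometry.HullSubordination
import Mathlib.Analysis.Complex.Convex
import Mathlib.Analysis.Complex.ReImTopology
import HarnessLib

/-!
# [LSW] Lemma 3.5, continuity of `F`: proof

G. F. Lawler, O. Schramm, W. Werner, *Conformal restriction: the chordal case*, J. Amer. Math.
Soc. **16** (2003) 917–955, arXiv:math/0209343 (**[LSW]**, arXiv page numbers), Lemma 3.5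
(p. 12) and its proof (p. 12). This proof-only file DISCHARGES the named fact
`Literature.Probability.RandomPlanarGeometry.LSWConverges.tendsto_measure_avoid`
(`RestrictionContinuity`): for a probability measure `P` on `Ω` multiplicative over products
(hypothesis (1) of Prop. 3.3 in homomorphism form), `F(A) = P[K ∩ A = ∅]` is continuous along
`A_n → A` in `𝒬₊` in the sense of the proof of Lemma 3.5 (`LSWConverges`), see
`LSWConverges.tendsto_measure_avoid_holds`; the dilation invariance in (1) is not used
(`LSWConverges.tendsto_measure_avoid_of_isHullMultiplicative`).

The printed proof (p. 12) and its transcription: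

1. **(3.4): `A_n^+ ∪ A_n^- ⊆ {x + iy : x ∈ [δ, 1/δ], y ≤ δ_n}`, `δ_n → 0`**, for
   `A_n^+ = Φ_{A_n}(A ∖ A_n)`, `A_n^- = Φ_A(A_n ∖ A)`. Here, for every `η > 0`, EVENTUALLY
   `A_n^± ⊆ 𝖳[c, R, η] = {c ≤ |x| ≤ R, 0 ≤ y ≤ η}` (a two-sided thin box: we do not track the
   sign of `x`, which the paper gets from `𝒬₊`-considerations it leaves implicit):
   `LSWConverges.exists_eventually_minus_subset` ("`Φ_A⁻¹ ∘ Φ_{A_n} → id` … implies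
   `A_n^- ∩ S = ∅`": the compact `Φ_A⁻¹(S)` is eventually disjoint from `A_n`, and `Φ_A` is
   bounded and bounded below on the annulus containing the `A_n`) and
   `LSWConverges.exists_eventually_plus_subset` ("for every compact `S ⊂ ℍ`, for all
   sufficiently large `n`, `S` is contained in the image of `Φ_{A_n} ∘ Φ_A⁻¹`": by Koebe's
   one-quarter theorem for these maps, which converge to the identity,
   `PlusHullKoebe.eventually_ball_subset_image`, on a finite cover of `S` by discs; the
   uniform bounds `δ Φ_A'(0)/8 ≤ |Φ_{A_n}| ≤ 8/δ` on `A ∖ A_n` are Koebe's theorem at `0` and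
   at `∞` for the Schwarz-reflection extensions `E_{A_n}`, `PlusHullKoebe`).
2. **"Suppose `limsup F(A_n) > F(A)` … by mapping over with `Φ_A` and using 1 … `K` intersects
   infinitely many `A_n^-` … `P[K ∩ [δ, 1/δ] ≠ ∅] > 0`, a contradiction."** We use (1) through
   the product inequality `measure_avoid_le_of_hullProduct`: for `*`-hulls `H`, `B`,
   `F(B) ≤ P(E) + 1 - F(H)` whenever `{K ∩ (H · B) = ∅} ⊆ E`. With `H = hpFill 𝖳` (a `*`-hull,
   `isStarHull_hpFill_thinBox`, Conway VIII.2.2 via `isSimplyConnected_of_isConnected_compl_holds`)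
   and step 1: `A_n ∩ ℍ ⊆ hpFill 𝖳 · A` gives `F(A) ≤ F(A_n) + 1 - F(hpFill 𝖳)`, and
   `A ∩ ℍ ⊆ hpFill 𝖳 · A_n` gives `F(A_n) ≤ F(A) + 1 - F(hpFill 𝖳)`; finally
   `F(hpFill 𝖳[c, R, η]) = P[K ∩ 𝖳 = ∅] → 1` as `η ↓ 0` (`tendsto_measure_avoid_thinBox`: a
   configuration accumulates on `ℝ` only at `0`, the paper's "contradiction").

Degenerate cases: `A = ∅` (then `F(A) = 1` and only the lower bound is needed) and `A_n = ∅`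
(impossible for infinitely many `n` unless `A = ∅`, `LSWConverges.eventually_nonempty`).

## References

* [LSW] Lemma 3.5 and its proof, arXiv p. 12 [LawlerSchrammWerner2003Restriction].
-/

noncomputable section

open Set Filter Metric MeasureTheory Bornology Complex
open _root_.Topology
open UpperHalfPlane (upperHalfPlaneSet isOpen_upperHalfPlaneSet)
open scoped NNReal ENNReal ComplexConjugate

namespace Literature.Probability.RandomPlanarGeometry

open RestrictionConfig


/-- The thin double box `{x + iy : c ≤ |x| ≤ R, 0 ≤ y ≤ η}` of the proof of [LSW] Lemma 3.5
(p. 12, (3.4): "`A_n^+ ∪ A_n^- ⊂ {x + iy : x ∈ [δ, 1/δ], y ≤ δ_n}`"), two-sided. -/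
local notation3 "𝖳[" c ", " R ", " η "]" =>
  ((Set.Icc c R ∪ Set.Icc (-R) (-c)) ×ℂ Set.Icc (0 : ℝ) η : Set ℂ)

/-! ### The thin double boxes and their fills -/

section Box

variable {c R η : ℝ}

/-- Membership in the thin double box (`c ≥ 0`). [folklore] -/
theorem mem_thinBox_iff (hc : 0 ≤ c) {z : ℂ} :
    z ∈ 𝖳[c, R, η] ↔ (c ≤ |z.re| ∧ |z.re| ≤ R) ∧ 0 ≤ z.im ∧ z.im ≤ η := by
  rw [mem_reProdIm, mem_union, mem_Icc, mem_Icc, mem_Icc]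
  constructor
  · rintro ⟨h | h, h2⟩
    · rw [abs_of_nonneg (hc.trans h.1)]; exact ⟨h, h2⟩
    · rw [abs_of_nonpos (by linarith [h.2] : z.re ≤ 0)]
      exact ⟨⟨by linarith [h.2], by linarith [h.1]⟩, h2⟩
  · rintro ⟨h, h2⟩
    refine ⟨?_, h2⟩
    rcases le_or_gt 0 z.re with h' | h'
    · rw [abs_of_nonneg h'] at h; exact Or.inl h
    · rw [abs_of_neg h'] at h; exact Or.inr ⟨by linarith [h.2], by linarith [h.1]⟩

/-- The thin double box is closed. [folklore] -/
theorem isClosed_thinBox : IsClosed 𝖳[c, R, η] :=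
  (isClosed_Icc.union isClosed_Icc).reProdIm isClosed_Icc

/-- The thin double box is bounded. [folklore] -/
theorem isBounded_thinBox : IsBounded 𝖳[c, R, η] :=
  ((isBounded_Icc c R).union (isBounded_Icc _ _)).reProdIm (isBounded_Icc 0 η)

/-- The thin double box is compact. [folklore] -/
theorem isCompact_thinBox : IsCompact 𝖳[c, R, η] :=
  Metric.isCompact_of_isClosed_isBounded isClosed_thinBox isBounded_thinBox

/-- Rectangles are convex. [folklore] -/
theorem convex_reProdIm {s t : Set ℝ} (hs : Convex ℝ s) (ht : Convex ℝ t) : Convex ℝ (s ×ℂ t) := by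
  rw [← convexHull_eq_self, Complex.convexHull_reProdIm, hs.convexHull_eq, ht.convexHull_eq]

/-- **The thin double box is attached**: together with the lower half-plane it is connected
(each of its two rectangles is convex and touches the real axis). [folklore] -/
theorem isConnected_thinBox_union (hcR : c ≤ R) (hη : 0 ≤ η) :
    IsConnected (𝖳[c, R, η] ∪ {z : ℂ | z.im ≤ 0}) := by
  have hL : IsConnected {z : ℂ | z.im ≤ 0} :=
    ⟨⟨0, by simp⟩, (convex_halfSpace_im_le (r := 0)).isPreconnected⟩
  have hrect : ∀ {a b : ℝ}, a ≤ b → IsConnected (Icc a b ×ℂ Icc 0 η) := fun {a b} hab ↦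
    ⟨⟨(a : ℂ), by rw [mem_reProdIm]; simp [hab, hη]⟩,
      (convex_reProdIm (convex_Icc a b) (convex_Icc 0 η)).isPreconnected⟩
  have h1 : IsConnected (Icc c R ×ℂ Icc 0 η ∪ {z : ℂ | z.im ≤ 0}) :=
    IsConnected.union ⟨(c : ℂ), by rw [mem_reProdIm]; simp [hcR, hη], by simp⟩ (hrect hcR) hL
  have h2 : IsConnected (Icc (-R) (-c) ×ℂ Icc 0 η ∪ (Icc c R ×ℂ Icc 0 η ∪ {z : ℂ | z.im ≤ 0})) :=
    IsConnected.union ⟨((-c : ℝ) : ℂ), by rw [mem_reProdIm]; simp [hcR, hη], Or.inr (by simp)⟩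
      (hrect (by linarith)) h1
  convert h2 using 1
  ext z
  simp only [mem_union, mem_reProdIm, mem_setOf_eq]
  tauto

/-- **`0` is not in the fill of the thin double box**: the imaginary axis is a transient path
from `0` in `ℍ ∪ {0}` avoiding the box (`c > 0`). [folklore] -/
theorem zero_notMem_hpFill_thinBox (hc : 0 < c) : (0 : ℂ) ∉ hpFill 𝖳[c, R, η] := by
  refine zero_notMem_hpFill_of_disjoint isClosed_thinBox (γ := fun t : ℝ≥0 ↦ I * (t : ℝ))
    (by fun_prop) (by simp) (fun t ht ↦ by simpa using ht) ?_ ?_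
  · have : (fun t : ℝ≥0 ↦ ‖I * ((t : ℝ) : ℂ)‖) = fun t : ℝ≥0 ↦ (t : ℝ) := by
      ext t; simp
    rw [this]
    exact NNReal.tendsto_coe_atTop.2 tendsto_id
  · refine Set.disjoint_left.2 ?_
    rintro _ ⟨t, rfl⟩ hz
    rw [mem_thinBox_iff hc.le] at hz
    simp at hz
    linarith [hz.1.1]

/-- **The fill of the thin double box is a `*`-hull** (`hpFill 𝖳 ∈ 𝒬*`; Conway VIII.2.2 for the
simple connectivity, `isSimplyConnected_of_isConnected_compl_holds`). [cite: LawlerSchrammWerner2003Restriction, §2 p. 8 (Fillings)] -/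
theorem isStarHull_hpFill_thinBox (hc : 0 < c) (hcR : c ≤ R) (hη : 0 ≤ η) :
    IsStarHull (hpFill 𝖳[c, R, η]) :=
  isStarHull_hpFill isSimplyConnected_of_isConnected_compl_holds isClosed_thinBox isBounded_thinBox
    (isConnected_thinBox_union hcR hη) (zero_notMem_hpFill_thinBox hc)

/-- The boxes shrink with `η`. [folklore] -/
theorem thinBox_mono {η η' : ℝ} (h : η ≤ η') : 𝖳[c, R, η] ⊆ 𝖳[c, R, η'] := fun z hz ↦ by
  rw [mem_reProdIm] at hz ⊢
  exact ⟨hz.1, hz.2.1, hz.2.2.trans h⟩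

/-- **Every configuration misses the thin boxes of small height**:
`⋃ₘ {K ∩ 𝖳[c, R, 1/(m+1)] = ∅} = Ω` for `c > 0` (a configuration accumulates on the real axis
only at `0`). [cite: LawlerSchrammWerner2003Restriction, proof of Lemma 3.5 (p. 12): "this would then imply that P[K ∩ [δ, 1/δ] ≠ ∅] > 0, a contradiction"] -/
theorem iUnion_avoid_thinBox (hc : 0 < c) :
    (⋃ m : ℕ, avoid 𝖳[c, R, 1 / ((m : ℝ) + 1)]) = univ := by
  refine eq_univ_of_forall fun K ↦ ?_
  by_contra hK
  simp only [mem_iUnion, mem_avoid, not_exists] at hK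
  -- a point `z m ∈ K ∩ 𝖳_m` for every `m`
  have hz : ∀ m : ℕ, ∃ z, z ∈ (K : Set ℂ) ∧ z ∈ 𝖳[c, R, 1 / ((m : ℝ) + 1)] := fun m ↦ by
    have := hK m
    rw [Set.not_disjoint_iff] at this
    exact this
  choose z hzK hzT using hz
  -- a convergent subsequence in the compact `𝖳_0`
  have hzT1 : ∀ m, z m ∈ 𝖳[c, R, 1] := fun m ↦ thinBox_mono (by
    rw [div_le_one (by positivity)]; linarith [m.cast_nonneg (α := ℝ)]) (hzT m)
  obtain ⟨w, hwT, φ, hφ, hlim⟩ := isCompact_thinBox.tendsto_subseq hzT1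
  -- the limit is real, with `c ≤ |re w|`, and lies in `cl K`
  have hwcl : w ∈ closure (K : Set ℂ) := mem_closure_of_tendsto hlim (Eventually.of_forall fun m ↦ hzK _)
  have hwim : w.im = 0 := by
    have h1 : Tendsto (fun m ↦ (z (φ m)).im) atTop (𝓝 w.im) := (Complex.continuous_im.tendsto w).comp hlim
    have h2 : Tendsto (fun m : ℕ ↦ 1 / ((φ m : ℝ) + 1)) atTop (𝓝 0) := by
      have h3 : Tendsto (fun m : ℕ ↦ 1 / ((m : ℝ) + 1)) atTop (𝓝 0) := tendsto_one_div_add_atTop_nhds_zero_nat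
      exact h3.comp hφ.tendsto_atTop
    refine le_antisymm (le_of_tendsto_of_tendsto h1 h2 (Eventually.of_forall fun m ↦ ?_))
      (ge_of_tendsto h1 (Eventually.of_forall fun m ↦ ?_))
    · exact ((mem_thinBox_iff hc.le).1 (hzT (φ m))).2.2
    · exact ((mem_thinBox_iff hc.le).1 (hzT (φ m))).2.1
  have hwre : c ≤ |w.re| := ((mem_thinBox_iff hc.le).1 hwT).1.1
  -- contradiction with `cl K ∩ ℝ = {0}`
  have hwR : w ∈ closure (K : Set ℂ) ∩ range ((↑) : ℝ → ℂ) :=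
    ⟨hwcl, w.re, Complex.ext (by simp) (by simp [hwim])⟩
  rw [K.closure_inter_range_ofReal, mem_singleton_iff] at hwR
  rw [hwR] at hwre
  simp at hwre
  linarith

/-- **`P[K ∩ 𝖳_η = ∅] → 1` as `η = 1/(m+1) ↓ 0`**, for every probability measure on `Ω`.
[cite: LawlerSchrammWerner2003Restriction, proof of Lemma 3.5 (p. 12)] -/
theorem tendsto_measure_avoid_thinBox (P : Measure RestrictionConfig) [IsProbabilityMeasure P]
    (hc : 0 < c) :
    Tendsto (fun m : ℕ ↦ P (avoid 𝖳[c, R, 1 / ((m : ℝ) + 1)])) atTop (𝓝 1) := by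
  have hmono : Monotone fun m : ℕ ↦ avoid 𝖳[c, R, 1 / ((m : ℝ) + 1)] := by
    intro m m' hmm' K hK
    refine hK.mono_right (thinBox_mono ?_)
    gcongr
  have := tendsto_measure_iUnion_atTop (μ := P) hmono
  rwa [iUnion_avoid_thinBox hc, measure_univ] at this

end Box

/-! ### The product inequality -/

section Product

variable {P : Measure RestrictionConfig} [IsProbabilityMeasure P]

/-- **`F(B) ≤ P(E) + 1 - F(H)` whenever `{K ∩ (H · B) = ∅} ⊆ E`**, for `H, B ∈ 𝒬*` and `P`
multiplicative over products: `{K ∩ B = ∅} ⊆ E ∪ ({K ∩ B = ∅} ∖ {K ∩ (H·B) = ∅})` and the last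
event has probability `F(B) - F(H·B) = F(B)(1 - F(H)) ≤ 1 - F(H)`. This replaces "mapping over
with `Φ_A` and using 1" in the printed proof. [cite: LawlerSchrammWerner2003Restriction, proof of Lemma 3.5 (p. 12)] -/
theorem measure_avoid_le_of_hullProduct (hmul : IsHullMultiplicative P) {H B : Set ℂ}
    (hH : IsStarHull H) (hB : IsStarHull B) {ΦB : ConformalEquiv (upperHalfPlaneSet \ B) upperHalfPlaneSet}
    (hΦB : IsRestrictionMap B ΦB) {E : Set RestrictionConfig}
    (hE : avoid (hullProduct H B ΦB) ⊆ E) : P (avoid B) ≤ P E + (1 - P (avoid H)) := by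
  have hHc : IsClosed H := hH.isBoundedHull.isClosed
  have hBc : IsClosed B := hB.isBoundedHull.isClosed
  set C := hullProduct H B ΦB with hC
  have hprod : IsHullProduct H B C := isHullProduct_hullProduct hH hB hΦB
  have hCB : avoid C ⊆ avoid B := fun K hK ↦ Set.disjoint_left.2 fun z hzK hzB ↦ by
    have hz : z ∈ upperHalfPlaneSet := K.subset_upperHalfPlaneSet hzK
    have : z ∈ C := by
      by_contra hzC
      exact ((notMem_hullProduct_iff hHc hBc hz).1 hzC).1 hzB
    exact Set.disjoint_left.1 hK hzK this
  have hFC : P (avoid C) = P (avoid H) * P (avoid B) := hmul _ _ _ hH hB hprod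
  have hmB : MeasurableSet (avoid B) := measurableSet_avoid hB
  have hmC : MeasurableSet (avoid C) := measurableSet_avoid hprod.1
  -- `F(B) = F(C) + P(avoid B \ avoid C)`
  have hsplit : P (avoid B) = P (avoid C) + P (avoid B \ avoid C) := by
    rw [← measure_inter_add_sdiff (avoid B) hmC, inter_eq_self_of_subset_right hCB]
  -- `P(avoid B \ avoid C) ≤ 1 - F(H)`
  have hdiff : P (avoid B \ avoid C) ≤ 1 - P (avoid H) := by
    have h1 : P (avoid B \ avoid C) = P (avoid B) - P (avoid C) :=
      measure_sdiff hCB hmC.nullMeasurableSet (measure_ne_top _ _)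
    rw [h1, hFC]
    calc P (avoid B) - P (avoid H) * P (avoid B)
        = 1 * P (avoid B) - P (avoid H) * P (avoid B) := by rw [one_mul]
      _ = (1 - P (avoid H)) * P (avoid B) := (ENNReal.sub_mul fun _ _ ↦ measure_ne_top _ _).symm
      _ ≤ (1 - P (avoid H)) * 1 := by gcongr; exact prob_le_one
      _ = 1 - P (avoid H) := mul_one _
  calc P (avoid B) = P (avoid C) + P (avoid B \ avoid C) := hsplit
    _ ≤ P E + (1 - P (avoid H)) := add_le_add (measure_mono hE) hdiff

end Product

/-! ### Bounds for a fixed restriction map -/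

section FixedMap

variable {A : Set ℂ} (hA : IsStarHull A) {Φ : ConformalEquiv (upperHalfPlaneSet \ A) upperHalfPlaneSet}
  (hΦ : IsRestrictionMap A Φ)
include hA hΦ

/-- A restriction map is bounded on bounded parts of `ℍ ∖ A`. [folklore] -/
theorem IsRestrictionMap.exists_norm_le (ρ : ℝ) :
    ∃ M : ℝ, 0 < M ∧ ∀ z ∈ upperHalfPlaneSet \ A, ‖z‖ ≤ ρ → ‖Φ z‖ ≤ M := by
  obtain ⟨Φ₀, hΦ₀, -, hinf, -⟩ := hA.exists_restrictionMap_tendsto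
  obtain ⟨M, hM⟩ := exists_forall_norm_apply_le_of_tendsto_symm_cocompact (A' := A) hinf ρ
  obtain ⟨Φ₁, -, hU⟩ := IsStarHull.existsUnique_isRestrictionMap_holds hA
  refine ⟨max M 1, by positivity, fun z hz hzρ ↦ ?_⟩
  rw [hU Φ hΦ hz, ← hU Φ₀ hΦ₀ hz]
  exact (hM z hz hzρ).trans (le_max_left _ _)

/-- A restriction map is bounded away from `0` away from `0`. [folklore] -/
theorem IsRestrictionMap.exists_le_norm {ρ : ℝ} (hρ : 0 < ρ) :
    ∃ c : ℝ, 0 < c ∧ ∀ z ∈ upperHalfPlaneSet \ A, ρ ≤ ‖z‖ → c ≤ ‖Φ z‖ := by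
  obtain ⟨Φ₀, hΦ₀, h0, -, -⟩ := hA.exists_restrictionMap_tendsto
  obtain ⟨c, hc, hcz⟩ := exists_forall_le_norm_apply_of_tendsto_symm_nhds (A' := A) h0 hρ
  obtain ⟨Φ₁, -, hU⟩ := IsStarHull.existsUnique_isRestrictionMap_holds hA
  refine ⟨c, hc, fun z hz hzρ ↦ ?_⟩
  rw [hU Φ hΦ hz, ← hU Φ₀ hΦ₀ hz]
  exact hcz z hz hzρ

end FixedMap

/-! ### The sets `A_n^-` are eventually thin ([LSW] (3.4), `A_n^- = Φ_A(A_n ∖ A)`) -/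

section Minus

variable {A : Set ℂ} {Φ : ConformalEquiv (upperHalfPlaneSet \ A) upperHalfPlaneSet}
  {An : ℕ → Set ℂ} {Φn : ∀ n, ConformalEquiv (upperHalfPlaneSet \ An n) upperHalfPlaneSet}

/-- **`A_n^- = Φ_A(A_n ∖ A)` lies in a thin double box, eventually** ([LSW] (3.4) for `A_n^-`,
p. 12: "`Φ_A⁻¹ ∘ Φ_{A_n}` converges … to the identity map, and this implies that `A_n^- ∩ S = ∅`
for all sufficiently large `n`. It is easy to verify that `A_n^+ ∪ A_n^-` is bounded and bounded
away from `0`"): here from the eventual disjointness of `A_n` from the compact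
`Φ_A⁻¹({|x| ≤ M, η ≤ y ≤ M})` and the bounds `c₀ ≤ |Φ_A| ≤ M` on the annulus containing the `A_n`.
[cite: LawlerSchrammWerner2003Restriction, proof of Lemma 3.5, (3.4) (p. 12)] -/
theorem LSWConverges.exists_eventually_minus_subset (h : LSWConverges A Φ An Φn) (hA : IsStarHull A)
    (hΦ : IsRestrictionMap A Φ) :
    ∃ c R : ℝ, 0 < c ∧ c ≤ R ∧ ∀ η : ℝ, 0 < η →
      ∀ᶠ n in atTop, ∀ w ∈ (An n \ A) ∩ upperHalfPlaneSet, Φ w ∈ 𝖳[c, R, η] := by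
  obtain ⟨δ, hδ, hAnδ⟩ := h.exists_bound
  obtain ⟨M, hM0, hM⟩ := hΦ.exists_norm_le hA δ⁻¹
  obtain ⟨c₀, hc₀, hc₀z⟩ := hΦ.exists_le_norm hA hδ
  refine ⟨c₀ / 2, max M c₀, by positivity, by linarith [le_max_right M c₀], fun η hη ↦ ?_⟩
  set η' := min η (c₀ / 2) with hη'
  have hη'0 : 0 < η' := lt_min hη (by positivity)
  -- the compact `S' = {|x| ≤ M, η' ≤ y ≤ M}` and its preimage
  set S' : Set ℂ := Icc (-M) M ×ℂ Icc η' M with hS'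
  have hS'c : IsCompact S' := isCompact_Icc.reProdIm isCompact_Icc
  have hS'H : S' ⊆ upperHalfPlaneSet := fun u hu ↦ by
    rw [hS', mem_reProdIm, mem_Icc, mem_Icc] at hu
    exact (show 0 < u.im from hη'0.trans_le hu.2.1)
  set C' := Φ.symm '' S' with hC'
  have hC'c : IsCompact C' := hS'c.image_of_continuousOn (Φ.symm.continuousOn.mono hS'H)
  have hC'A : C' ⊆ upperHalfPlaneSet \ A := by
    rintro _ ⟨u, hu, rfl⟩; exact Φ.symm_mapsTo (hS'H hu)
  filter_upwards [h.eventually_disjoint hC'c hC'A] with n hn w hw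
  obtain ⟨⟨hwAn, hwA⟩, hwH⟩ := hw
  have hwU : w ∈ upperHalfPlaneSet \ A := ⟨hwH, hwA⟩
  obtain ⟨hwδ, hwδ'⟩ := hAnδ n hwAn
  have hu : Φ w ∈ upperHalfPlaneSet := Φ.mapsTo hwU
  have huM : ‖Φ w‖ ≤ M := hM w hwU hwδ'
  have huc : c₀ ≤ ‖Φ w‖ := hc₀z w hwU hwδ
  have hre : |(Φ w).re| ≤ M := (abs_re_le_norm _).trans huM
  have him : (Φ w).im ≤ M := (abs_im_le_norm _).trans' (le_abs_self _) |>.trans huM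
  -- `im Φ w < η'`, else `w ∈ C' ∩ A_n`
  have himlt : (Φ w).im < η' := by
    by_contra hge
    rw [not_lt] at hge
    have huS : Φ w ∈ S' := by
      rw [hS', mem_reProdIm, mem_Icc, mem_Icc, ← abs_le]
      exact ⟨hre, hge, him⟩
    have hwC : w ∈ C' := ⟨Φ w, huS, Φ.symm_apply_apply hwU⟩
    exact Set.disjoint_left.1 hn hwC hwAn
  rw [mem_thinBox_iff (by positivity)]
  have h1 := norm_le_abs_re_add_abs_im (Φ w)
  have h2 : |(Φ w).im| = (Φ w).im := abs_of_pos hu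
  refine ⟨⟨?_, hre.trans (le_max_left _ _)⟩, (show 0 < (Φ w).im from hu).le,
    himlt.le.trans (min_le_left _ _)⟩
  have : η' ≤ c₀ / 2 := min_le_right _ _
  linarith

end Minus

/-! ### The sets `A_n^+` are eventually thin ([LSW] (3.4), `A_n^+ = Φ_{A_n}(A ∖ A_n)`) -/

section Plus

variable {A : Set ℂ} {Φ : ConformalEquiv (upperHalfPlaneSet \ A) upperHalfPlaneSet}
  {An : ℕ → Set ℂ} {Φn : ∀ n, ConformalEquiv (upperHalfPlaneSet \ An n) upperHalfPlaneSet}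

/-- **`A_n^+ = Φ_{A_n}(A ∖ A_n)` lies in a thin double box, eventually** ([LSW] (3.4) for `A_n^+`,
p. 12: "since the map `Φ_{A_n} ∘ Φ_A⁻¹` converges to the identity, locally uniformly in `ℍ`, it
follows (e.g., from the argument principle) that for every compact set `S ⊂ ℍ` for all
sufficiently large `n`, `S` is contained in the image of `Φ_{A_n} ∘ Φ_A⁻¹`, which means that
`A_n^+ ∩ S = ∅`"). Here the covering of `S = {|x| ≤ M, η ≤ y ≤ M}` is obtained from Koebe's
one-quarter theorem (`eventually_ball_subset_image`), and the bounds
`δ Φ_A'(0)/8 ≤ |Φ_{A_n}(w)| ≤ 8/δ` on `A ∖ A_n`, uniform in `n`, from Koebe's theorem for the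
Schwarz-reflection extensions `E_{A_n}` at `0` and at `∞` (`PlusHullKoebe`).
[cite: LawlerSchrammWerner2003Restriction, proof of Lemma 3.5, (3.4) (p. 12)] -/
theorem LSWConverges.exists_eventually_plus_subset (h : LSWConverges A Φ An Φn) (hA : IsPlusHull A)
    (hΦ : IsRestrictionMap A Φ) (hAn : ∀ n, IsPlusHull (An n))
    (hAnne : ∀ᶠ n in atTop, (An n).Nonempty) (hΦn : ∀ n, IsRestrictionMap (An n) (Φn n)) :
    ∃ c R : ℝ, 0 < c ∧ c ≤ R ∧ ∀ η : ℝ, 0 < η →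
      ∀ᶠ n in atTop, ∀ w ∈ (A \ An n) ∩ upperHalfPlaneSet, Φn n w ∈ 𝖳[c, R, η] := by
  -- a common annulus for `A` and the `A_n`
  obtain ⟨δ₁, hδ₁, hAnδ₁⟩ := h.exists_bound
  obtain ⟨δ₂, hδ₂, hAδ₂⟩ := hA.1.exists_subset_norm_annulus
  set δ := min δ₁ δ₂ with hδ
  have hδ0 : 0 < δ := lt_min hδ₁ hδ₂
  have hannA : ∀ z ∈ A, δ ≤ ‖z‖ ∧ ‖z‖ ≤ δ⁻¹ := fun z hz ↦
    ⟨(min_le_right _ _).trans (hAδ₂ hz).1,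
      (hAδ₂ hz).2.trans ((inv_le_inv₀ hδ₂ hδ0).2 (min_le_right _ _))⟩
  have hannAn : ∀ n, ∀ z ∈ An n, δ ≤ ‖z‖ ∧ ‖z‖ ≤ δ⁻¹ := fun n z hz ↦
    ⟨(min_le_left _ _).trans (hAnδ₁ n hz).1,
      (hAnδ₁ n hz).2.trans ((inv_le_inv₀ hδ₁ hδ0).2 (min_le_left _ _))⟩
  -- the derivatives `d_n → d > 0`
  obtain ⟨d, hd0, -, hd⟩ := IsStarHull.exists_hasRestrictionDeriv_holds hA.1 hΦ
  choose dn _ _ hdn using fun n ↦ IsStarHull.exists_hasRestrictionDeriv_holds (hAn n).1 (hΦn n)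
  have hdlim : Tendsto dn atTop (𝓝 d) :=
    h.tendsto_restrictionDeriv hA.1 (fun n ↦ (hAn n).1) hΦ hΦn hd hdn
  have hdn2 : ∀ᶠ n in atTop, d / 2 ≤ dn n :=
    (hdlim.eventually (eventually_ge_nhds (by linarith : d / 2 < d)))
  -- the constants
  set c₀ : ℝ := δ * d / 8 with hc₀
  set M : ℝ := 8 / δ with hM
  have hc₀0 : 0 < c₀ := by positivity
  have hM0 : 0 < M := by positivity
  refine ⟨c₀ / 2, max M c₀, by positivity, by linarith [le_max_right M c₀], fun η hη ↦ ?_⟩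
  set η' := min η (c₀ / 2) with hη'
  have hη'0 : 0 < η' := lt_min hη (by positivity)
  -- uniform bounds on `A ∖ A_n`
  have hbounds : ∀ᶠ n in atTop, ∀ w ∈ (A \ An n) ∩ upperHalfPlaneSet,
      c₀ ≤ ‖Φn n w‖ ∧ ‖Φn n w‖ ≤ M := by
    filter_upwards [hAnne, hdn2] with n hne hdn2' w hw
    obtain ⟨⟨hwA, hwAn⟩, hwH⟩ := hw
    have hwU : w ∈ upperHalfPlaneSet \ An n := ⟨hwH, hwAn⟩
    have hwΩ : w ∈ plusDomain (An n) := ((hAn n).mem_plusDomain_iff_of_im_pos hwH).2 hwAn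
    have hEw : (hAn n).extMap hne w = Φn n w := by
      rw [(hAn n).extMap_of_mem_diff hne hwU, ← (hAn n).eqOn_baseMap hne (hΦn n) hwU]
    obtain ⟨hwδ, hwδ'⟩ := hannA w hwA
    constructor
    · have h1 := (hAn n).le_norm_extMap hne hδ0 (fun z hz ↦ (hannAn n z hz).1) (hΦn n) (hdn n) hwΩ hwδ
      rw [hEw] at h1
      refine le_trans ?_ h1
      rw [hc₀]
      have : δ * (d / 2) ≤ δ * dn n := mul_le_mul_of_nonneg_left hdn2' hδ0.le
      linarith
    · have h1 := (hAn n).norm_extMap_le hne hδ0 (fun z hz ↦ (hannAn n z hz).2) hwΩ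
        (hwδ'.trans (by rw [inv_eq_one_div]; gcongr; norm_num))
      rwa [hEw] at h1
  -- the compact `S' = {|x| ≤ M, η' ≤ y ≤ M}` is covered by small balls
  set S' : Set ℂ := Icc (-M) M ×ℂ Icc η' M with hS'
  have hS'c : IsCompact S' := isCompact_Icc.reProdIm isCompact_Icc
  have hS'im : ∀ u ∈ S', η' ≤ u.im := fun u hu ↦ by
    rw [hS', mem_reProdIm, mem_Icc, mem_Icc] at hu; exact hu.2.1
  set r : ℝ := η' / 2 with hr
  have hr0 : 0 < r := by positivity
  obtain ⟨t, htS, htf, hcover⟩ := hS'c.finite_cover_balls (e := r / 8) (by positivity)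
  -- the balls `B(u, r)`, `u ∈ t`, lie in `ℍ`; their closed preimages are compact in `ℍ ∖ A`
  have hballH : ∀ u ∈ t, closedBall u r ⊆ upperHalfPlaneSet := fun u hu v hv ↦ by
    have h1 := hS'im u (htS hu)
    rw [mem_closedBall, dist_eq_norm] at hv
    have h2 := abs_im_le_norm (v - u)
    rw [sub_im] at h2
    show 0 < v.im
    have := (abs_le.1 (h2.trans hv)).1
    rw [hr] at this
    linarith
  have hCu : ∀ u ∈ t, IsCompact (Φ.symm '' closedBall u r) ∧ Φ.symm '' closedBall u r ⊆ upperHalfPlaneSet \ A :=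
    fun u hu ↦ ⟨(isCompact_closedBall u r).image_of_continuousOn (Φ.symm.continuousOn.mono (hballH u hu)),
      by rintro _ ⟨v, hv, rfl⟩; exact Φ.symm_mapsTo (hballH u hu hv)⟩
  -- eventually, for every `u ∈ t`: `A_n` misses the preimage and `B(u, r/8) ⊆ Φ_n(Φ⁻¹(B(u, r)))`
  have hev : ∀ᶠ n in atTop, ∀ u ∈ t, Disjoint (Φ.symm '' closedBall u r) (An n) ∧
      ball u (r / 8) ⊆ (Φn n ∘ Φ.symm) '' ball u r := by
    rw [htf.eventually_all]
    intro u hu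
    obtain ⟨hCc, hCA⟩ := hCu u hu
    have hdisj := h.eventually_disjoint hCc hCA
    have hunif := h.tendstoUniformlyOn hCc hCA
    refine hdisj.and (eventually_ball_subset_image hr0 ?_ ?_)
    · filter_upwards [hdisj] with n hn
      have hmaps : MapsTo Φ.symm (ball u r) (upperHalfPlaneSet \ An n) := fun v hv ↦
        ⟨(Φ.symm_mapsTo (hballH u hu (ball_subset_closedBall hv))).1,
          fun h' ↦ Set.disjoint_left.1 hn ⟨v, ball_subset_closedBall hv, rfl⟩ h'⟩
      refine ⟨(Φn n).differentiableOn.comp (Φ.symm.differentiableOn.mono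
        ((ball_subset_closedBall).trans (hballH u hu))) hmaps, ?_⟩
      exact (Φn n).injOn.comp (Φ.symm.injOn.mono ((ball_subset_closedBall).trans (hballH u hu))) hmaps
    · have h1 : TendstoUniformlyOn (fun n ↦ (Φn n : ℂ → ℂ) ∘ Φ.symm) ((Φ : ℂ → ℂ) ∘ Φ.symm) atTop
          (ball u r) :=
        (hunif.comp Φ.symm).mono fun v hv ↦ ⟨v, ball_subset_closedBall hv, rfl⟩
      refine h1.congr_right fun v hv ↦ ?_
      exact Φ.apply_symm_apply (hballH u hu (ball_subset_closedBall hv))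
  filter_upwards [hbounds, hev] with n hbn hevn w hw
  obtain ⟨hwc, hwM⟩ := hbn w hw
  obtain ⟨⟨hwA, hwAn⟩, hwH⟩ := hw
  have hwU : w ∈ upperHalfPlaneSet \ An n := ⟨hwH, hwAn⟩
  have hu : Φn n w ∈ upperHalfPlaneSet := (Φn n).mapsTo hwU
  have hre : |(Φn n w).re| ≤ M := (abs_re_le_norm _).trans hwM
  have him : (Φn n w).im ≤ M := (abs_im_le_norm _).trans' (le_abs_self _) |>.trans hwM
  -- `im Φ_n w < η'`, else `Φ_n w ∈ S'` is a value `Φ_n(z')` with `z' ∉ A`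
  have himlt : (Φn n w).im < η' := by
    by_contra hge
    rw [not_lt] at hge
    have huS : Φn n w ∈ S' := by
      rw [hS', mem_reProdIm, mem_Icc, mem_Icc, ← abs_le]
      exact ⟨hre, hge, him⟩
    obtain ⟨u, hu, huball⟩ := mem_iUnion₂.1 (hcover huS)
    obtain ⟨hdisj, himage⟩ := hevn u hu
    obtain ⟨v, hv, hvw⟩ := himage huball
    set z' := Φ.symm v with hz'
    have hz'A : z' ∈ upperHalfPlaneSet \ A := Φ.symm_mapsTo (hballH u hu (ball_subset_closedBall hv))
    have hz'An : z' ∉ An n := fun h' ↦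
      Set.disjoint_left.1 hdisj ⟨v, ball_subset_closedBall hv, rfl⟩ h'
    have heq : w = z' := (Φn n).injOn hwU ⟨hz'A.1, hz'An⟩ hvw.symm
    exact hz'A.2 (heq ▸ hwA)
  rw [mem_thinBox_iff (by positivity)]
  have h1 := norm_le_abs_re_add_abs_im (Φn n w)
  have h2 : |(Φn n w).im| = (Φn n w).im := abs_of_pos hu
  refine ⟨⟨?_, hre.trans (le_max_left _ _)⟩, (show 0 < (Φn n w).im from hu).le,
    himlt.le.trans (min_le_left _ _)⟩
  have : η' ≤ c₀ / 2 := min_le_right _ _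
  linarith

end Plus

/-! ### Assembly: `F` is continuous -/

section Assembly

variable {A : Set ℂ} {Φ : ConformalEquiv (upperHalfPlaneSet \ A) upperHalfPlaneSet}
  {An : ℕ → Set ℂ} {Φn : ∀ n, ConformalEquiv (upperHalfPlaneSet \ An n) upperHalfPlaneSet}

/-- A restriction map of the empty hull is the identity on `ℍ` (uniqueness of `Φ_∅ = id`). [folklore] -/
theorem IsRestrictionMap.apply_eq_self_of_eq_empty {B : Set ℂ} (hB : B = ∅)
    {Ψ : ConformalEquiv (upperHalfPlaneSet \ B) upperHalfPlaneSet} (hΨ : IsRestrictionMap B Ψ)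
    {z : ℂ} (hz : z ∈ upperHalfPlaneSet) : Ψ z = z := by
  subst hB
  obtain ⟨Φ₀, -, hU⟩ := IsStarHull.existsUnique_isRestrictionMap_holds isStarHull_empty
  have hz' : z ∈ upperHalfPlaneSet \ (∅ : Set ℂ) := by simpa using hz
  rw [hU Ψ hΨ hz', ← hU restrictionMapEmpty isRestrictionMap_empty hz', restrictionMapEmpty_apply]

/-- **If `A_n → A ≠ ∅` then eventually `A_n ≠ ∅`**: along the indices with `A_n = ∅` the maps
`Φ_{A_n}` are the identity, so `Φ_A = id` on `ℍ ∖ A` and `Φ_A(ℍ ∖ A) = ℍ` forces `A ∩ ℍ = ∅`.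
[folklore] -/
theorem LSWConverges.eventually_nonempty (h : LSWConverges A Φ An Φn) (hA : IsStarHull A)
    (hAne : A.Nonempty) (hΦn : ∀ n, IsRestrictionMap (An n) (Φn n)) :
    ∀ᶠ n in atTop, (An n).Nonempty := by
  by_contra hnot
  have hfr : ∃ᶠ n in atTop, An n = ∅ := by
    rw [not_eventually] at hnot
    exact hnot.mono fun n hn ↦ not_nonempty_iff_eq_empty.1 hn
  -- `Φ = id` on `ℍ ∖ A`
  have hid : ∀ z ∈ upperHalfPlaneSet \ A, Φ z = z := fun z hz ↦ by
    have h1 : Tendsto (fun n ↦ Φn n z) atTop (𝓝 (Φ z)) :=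
      (h.tendstoUniformlyOn isCompact_singleton (singleton_subset_iff.2 hz)).tendsto_at
        (mem_singleton z)
    have h2 : ∃ᶠ n in atTop, Φn n z = z :=
      hfr.mono fun n hn ↦ IsRestrictionMap.apply_eq_self_of_eq_empty hn (hΦn n) hz.1
    exact tendsto_nhds_unique_of_frequently_eq h1 tendsto_const_nhds h2
  -- hence `A ∩ ℍ = ∅`, contradicting `A = cl (A ∩ ℍ) ≠ ∅`
  obtain ⟨a, ha⟩ := hAne
  have hAH : (A ∩ upperHalfPlaneSet).Nonempty := by
    by_contra hemp
    rw [not_nonempty_iff_eq_empty] at hemp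
    have := hA.isBoundedHull.closure_inter_eq
    rw [hemp, closure_empty] at this
    rw [← this] at ha
    exact ha
  obtain ⟨z, hzA, hzH⟩ := hAH
  obtain ⟨v, hv, hvz⟩ := Φ.bijOn.surjOn hzH
  rw [hid v hv] at hvz
  exact hv.2 (hvz ▸ hzA)

/-- **[LSW] Lemma 3.5, continuity of `F`** for a probability measure on `Ω` multiplicative
over products (no dilation invariance needed): `F(A_n) → F(A)` along `A_n → A` in `𝒬₊`.
For `ε > 0` choose thin double boxes `𝖳₁, 𝖳₂` with `P[K ∩ 𝖳ᵢ ≠ ∅] < ε`; eventually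
`A_n^- ⊆ 𝖳₁` and `A_n^+ ⊆ 𝖳₂`, i.e. `A_n ⊆ hpFill 𝖳₁ · A` and `A ⊆ hpFill 𝖳₂ · A_n` inside `ℍ`,
so by the product inequality `F(A) ≤ F(A_n) + ε` and `F(A_n) ≤ F(A) + ε`. (The dilation
invariance in hypothesis (1) is not needed for this clause.)
[cite: LawlerSchrammWerner2003Restriction, Lemma 3.5 (p. 12), continuity of F; proof p. 12] -/
theorem LSWConverges.tendsto_measure_avoid_of_isHullMultiplicative (P : Measure RestrictionConfig)
    [IsProbabilityMeasure P] (hmul : IsHullMultiplicative P) (hA : IsPlusHull A)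
    (hΦ : IsRestrictionMap A Φ) (hAn : ∀ n, IsPlusHull (An n))
    (hΦn : ∀ n, IsRestrictionMap (An n) (Φn n)) (hconv : LSWConverges A Φ An Φn) :
    Tendsto (fun n ↦ P (avoid (An n))) atTop (𝓝 (P (avoid A))) := by
  rw [ENNReal.tendsto_nhds (measure_ne_top _ _)]
  intro ε hε
  have hε1 : (1 : ℝ≥0∞) - ε < 1 := ENNReal.sub_lt_self ENNReal.one_ne_top one_ne_zero hε.ne'
  -- a thin box `𝖳[c, R, η]` with `1 - P[K ∩ 𝖳 = ∅] ≤ ε`, for given `c, R`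
  have hbox : ∀ {c R : ℝ}, 0 < c → c ≤ R → ∃ η : ℝ, 0 < η ∧
      IsStarHull (hpFill 𝖳[c, R, η]) ∧ 1 - P (avoid (hpFill 𝖳[c, R, η])) ≤ ε := by
    intro c R hc hcR
    obtain ⟨m, hm⟩ := ((tendsto_order.1 (tendsto_measure_avoid_thinBox P (R := R) hc)).1 _ hε1).exists
    have hη0 : (0 : ℝ) < 1 / ((m : ℝ) + 1) := by positivity
    refine ⟨1 / ((m : ℝ) + 1), hη0, isStarHull_hpFill_thinBox hc hcR hη0.le, ?_⟩
    rw [avoid_hpFill isClosed_thinBox isBounded_thinBox, tsub_le_iff_left]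
    exact le_tsub_add.trans (add_le_add hm.le le_rfl)
  -- lower bound `F(A) ≤ F(A_n) + ε` via `A_n^-`
  have hlow : ∀ᶠ n in atTop, P (avoid A) ≤ P (avoid (An n)) + ε := by
    obtain ⟨c₁, R₁, hc₁, hcR₁, hminus⟩ := hconv.exists_eventually_minus_subset hA.1 hΦ
    obtain ⟨η₁, hη₁, hS₁, hFS₁⟩ := hbox hc₁ hcR₁
    filter_upwards [hminus η₁ hη₁] with n hn
    have hsub : avoid (hullProduct (hpFill 𝖳[c₁, R₁, η₁]) A Φ) ⊆ avoid (An n) := by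
      intro K hK
      rw [mem_avoid] at hK ⊢
      refine Set.disjoint_left.2 fun z hzK hzAn ↦ ?_
      have hz : z ∈ upperHalfPlaneSet := K.subset_upperHalfPlaneSet hzK
      refine Set.disjoint_left.1 hK hzK ?_
      by_contra hzC
      obtain ⟨hzA, hΦz⟩ := (notMem_hullProduct_iff (isClosed_hpFill _)
        hA.1.isBoundedHull.isClosed hz).1 hzC
      exact hΦz (inter_subset_hpFill _ ⟨hn z ⟨⟨hzAn, hzA⟩, hz⟩, Φ.mapsTo ⟨hz, hzA⟩⟩)
    exact (measure_avoid_le_of_hullProduct hmul hS₁ hA.1 hΦ hsub).trans (add_le_add le_rfl hFS₁)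
  -- upper bound `F(A_n) ≤ F(A) + ε` via `A_n^+`
  have hup : ∀ᶠ n in atTop, P (avoid (An n)) ≤ P (avoid A) + ε := by
    rcases A.eq_empty_or_nonempty with hAe | hAne
    · refine Eventually.of_forall fun n ↦ ?_
      have : P (avoid A) = 1 := by rw [hAe, avoid_empty, measure_univ]
      rw [this]
      exact prob_le_one.trans le_self_add
    · have hAnne := hconv.eventually_nonempty hA.1 hAne hΦn
      obtain ⟨c₂, R₂, hc₂, hcR₂, hplus⟩ := hconv.exists_eventually_plus_subset hA hΦ hAn hAnne hΦn
      obtain ⟨η₂, hη₂, hS₂, hFS₂⟩ := hbox hc₂ hcR₂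
      filter_upwards [hplus η₂ hη₂] with n hn
      have hsub : avoid (hullProduct (hpFill 𝖳[c₂, R₂, η₂]) (An n) (Φn n)) ⊆ avoid A := by
        intro K hK
        rw [mem_avoid] at hK ⊢
        refine Set.disjoint_left.2 fun z hzK hzA ↦ ?_
        have hz : z ∈ upperHalfPlaneSet := K.subset_upperHalfPlaneSet hzK
        refine Set.disjoint_left.1 hK hzK ?_
        by_contra hzC
        obtain ⟨hzAn, hΦz⟩ := (notMem_hullProduct_iff (isClosed_hpFill _)
          (hAn n).1.isBoundedHull.isClosed hz).1 hzC
        exact hΦz (inter_subset_hpFill _ ⟨hn z ⟨⟨hzA, hzAn⟩, hz⟩, (Φn n).mapsTo ⟨hz, hzAn⟩⟩)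
      exact (measure_avoid_le_of_hullProduct hmul hS₂ (hAn n).1 (hΦn n) hsub).trans
        (add_le_add le_rfl hFS₂)
  filter_upwards [hlow, hup] with n h1 h2
  exact ⟨tsub_le_iff_right.2 h1, h2⟩

/-- **[LSW] Lemma 3.5, continuity of `F`: the named fact
`Literature.Probability.RandomPlanarGeometry.LSWConverges.tendsto_measure_avoid` HOLDS** (from
`tendsto_measure_avoid_of_isHullMultiplicative`; the dilation invariance is not needed).
[cite: LawlerSchrammWerner2003Restriction, Lemma 3.5 (p. 12), continuity of F] -/
theorem LSWConverges.tendsto_measure_avoid_holds : LSWConverges.tendsto_measure_avoid :=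
  fun P _ _ hmul _ _ _ _ hA hΦ hAn hΦn hconv ↦
    LSWConverges.tendsto_measure_avoid_of_isHullMultiplicative P hmul hA hΦ hAn hΦn hconv

end Assembly

end Literature.Probability.RandomPlanarGeometry

end
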